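import Literature.MathematicalPhysics.QuantumFieldTheory.Balaban1983to89.B3Sect3DegreeCensus

/-!
# `Balaban1983to89.B3Sect2ThreeLegGraphs` — T. Bałaban, *(Higgs)₂,₃ quantum fields in a finite volume. III. Renormalization*,
Commun. Math. Phys. **88** (1983) 411–445 [Balaban1983Higgs3]: the PICTURES (2.18)–(2.21) pp. 429–430 — the divergent graphs with
two external scalar legs and one external vector leg — as graphs of the concrete family `B3Cor23Concrete.Graph`, together with the
two further graphs X1, X2 of that class found on the model (HOME/GAPS.md G-B3-03), and their degrees

statement-level skeleton of published theorems with citation tags; proofs where landed; nothing here is a claim about the Yang–Mills mass gap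

PDF held: `paper:balaban1983-higgs-2-3-quantum-fields-finite-volume` (journal page = PDF page + 410); the displays (2.18)–(2.22)
read as images (strip crops at full resolution): `…/b2b-balaban-ref1/pages/1983-cmp88-higgs23-III/1983-cmp88-higgs23-III-p019,
p020-x2.png` (pp. 429, 430).  CITATION HEADER (lean-in-tree rule).  lit-balaban TYPED SKELETON (HOME
`run/shared/lean/pub/lit-balaban/`), Phase 2, seat p18 (gen 3), unit `lit-balaban-p18`; SKELETON row **B3.Eq2.18-2.22** (cell so far:
«the pictorial classes (2.18)–(2.22) themselves not typed (enumeration = python evidence only, G-B3-03/T13)»), fold owner r15.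
Reading of the pictures (legend (1.17) p. 415): straight = φ′, wavy = vector leg/line, small circle = vertex (1.8)/(1.10), dot =
(1.6)/(1.7), arrowhead adjacent to a vertex = the differentiation of that vertex (1.8) (leg 0 of the model).  The external vector leg
of the class is read as a leg of the external field Ã (p. 414: *"All the A′-legs are contracted"*; the same pictures with an
uncontracted A′-leg are the other members of the class on the model, cf. `B3Sect3DivergentClasses.threeLeg_structure`).  (2.21g)
(the mass counterterm pictures) are, in the attached form of the model (p. 423), the graphs (2.21d)/(2.21f) themselves.  (2.22) is
an example of class formation (prose), not a further graph.

WHAT THIS MODULE CONTAINS (sorry-free; `def`s = eleven graphs and seven vertex assignments; no `Prop` fact introduced): `g218`,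
`g219`, `g220`, `g221a`, `g221b`, `g221c`, `g221d`, `g221e`, `g221f` (the nine pictures, (b)/(c) = the two printed placements of
the differentiations), `gX1` ((1.6) doubly φ′-linked to (1.8)_{0,1}), `gX2` ((1.8)_{0,1}–(1.8)_{1,0}–A′–(1.8)_{1,0} with a
φ′-tadpole) — G-B3-03's two extra members, now kernel objects —; `threeLeg_legs` (each: two external φ′-legs, no external A′-leg,
one Ã-leg, no external differentiation, by `rfl`) and `threeLeg_deg` (each: **D = 0 in d = 3**, via the budget formula
`B3Sect3DegreeCensus.two_deg_three_eq_budget`: one A′-line or one vertex (1.6)).  With `B3Sect3DivergentClasses.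
deg_eq_zero_of_twoScalar_oneVector` / `threeLeg_structure` (p248510) this is the kernel side of pp. 429–430; the completeness of the
list up to the placement of lines stays the mechanical check recorded in G-B3-03.  NOT here: 1PI / connectedness (not modelled).
-/

namespace Literature.MathematicalPhysics.QuantumFieldTheory.Balaban1983to89.B3Sect2ThreeLegGraphs

open Finset B3Prop1 B3Sect2Statements B3VertexBridge B3Cor23Concrete B3DivergentGraphs B3Sect3DegreeCensus

/-! ## Vertex assignments -/

/-- (2.18): (1.8)_{1,1} and (1.8)_{1,0}. [cite: Balaban1983Higgs3, (2.18) p.429] -/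
def kind218 : Fin 2 → VertexKind
  | 0 => .v18 1 1
  | 1 => .v18 1 0

/-- (2.19): (1.10)_{1,1} and (1.8)_{1,0}. [cite: Balaban1983Higgs3, (2.19) p.429] -/
def kind219 : Fin 2 → VertexKind
  | 0 => .v110 1 1
  | 1 => .v18 1 0

/-- (2.20), (2.21b), (2.21c) and X2: (1.8)_{0,1}, (1.8)_{1,0}, (1.8)_{1,0}. [cite: Balaban1983Higgs3, (2.20) p.429] -/
def kind220 : Fin 3 → VertexKind
  | 0 => .v18 0 1
  | 1 => .v18 1 0
  | 2 => .v18 1 0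

/-- (2.21a): (1.8)_{1,0} and (1.10)_{1,1}. [cite: Balaban1983Higgs3, (2.21) p.430] -/
def kind221a : Fin 2 → VertexKind
  | 0 => .v18 1 0
  | 1 => .v110 1 1

/-- (2.21d): (1.8)_{0,1} and (1.10)_{2,0}. [cite: Balaban1983Higgs3, (2.21) p.430] -/
def kind221d : Fin 2 → VertexKind
  | 0 => .v18 0 1
  | 1 => .v110 2 0

/-- (2.21e): (1.8)_{0,1} and (1.8)_{2,0}. [cite: Balaban1983Higgs3, (2.21) p.430] -/
def kind221e : Fin 2 → VertexKind
  | 0 => .v18 0 1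
  | 1 => .v18 2 0

/-- (2.21f) and X1: (1.8)_{0,1} and (1.6). [cite: Balaban1983Higgs3, (2.21) p.430] -/
def kind221f : Fin 2 → VertexKind
  | 0 => .v18 0 1
  | 1 => .v16

/-! ## The pictures (2.18)–(2.21) -/

/-- **(2.18)** p. 429 [PDF 19]: (1.8)_{1,1} (the external vector leg = its Ã-leg) and (1.8)_{1,0} joined by the φ′-line through both
differentiated legs and by the A′-line; the second φ′-leg of each vertex external. [cite: Balaban1983Higgs3, (2.18) p.429] -/
def g218 (nbar : ℕ) (hn : 1 ≤ nbar) : Graph nbar where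
  nV := 2
  kind := kind218
  adm i := by fin_cases i <;> simp [kind218, VertexKind.Admissible, hn]
  other x := match x with
    | ⟨0, .inl j⟩ => if j.val = 0 then some ⟨1, .inl ⟨0, by decide⟩⟩ else none
    | ⟨1, .inl j⟩ => if j.val = 0 then some ⟨0, .inl ⟨0, by decide⟩⟩ else none
    | ⟨0, .inr _⟩ => some ⟨1, .inr ⟨0, by decide⟩⟩
    | ⟨1, .inr _⟩ => some ⟨0, .inr ⟨0, by decide⟩⟩
  other_ne := by decide
  other_symm := by decide
  other_isLeft := by decide
  exists_line := by decide

/-- **(2.19)** p. 429: (1.10)_{1,1} and (1.8)_{1,0} joined by a φ′-line (carrying the differentiation of the (1.8)-vertex) and by the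
A′-line; the second φ′-leg of each vertex external. [cite: Balaban1983Higgs3, (2.19) p.429] -/
def g219 (nbar : ℕ) (hn : 1 ≤ nbar) : Graph nbar where
  nV := 2
  kind := kind219
  adm i := by fin_cases i <;> simp [kind219, VertexKind.Admissible, hn]
  other x := match x with
    | ⟨0, .inl j⟩ => if j.val = 0 then some ⟨1, .inl ⟨0, by decide⟩⟩ else none
    | ⟨1, .inl j⟩ => if j.val = 0 then some ⟨0, .inl ⟨0, by decide⟩⟩ else none
    | ⟨0, .inr _⟩ => some ⟨1, .inr ⟨0, by decide⟩⟩
    | ⟨1, .inr _⟩ => some ⟨0, .inr ⟨0, by decide⟩⟩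
  other_ne := by decide
  other_symm := by decide
  other_isLeft := by decide
  exists_line := by decide

/-- **(2.20)** p. 429 (the triangle): (1.8)_{0,1} on top joined by its two φ′-legs to two vertices (1.8)_{1,0} which are joined by the
A′-line; every differentiation on a φ′-line; the second φ′-legs of the bottom vertices external. [cite: Balaban1983Higgs3, (2.20) p.429] -/
def g220 (nbar : ℕ) (hn : 1 ≤ nbar) : Graph nbar where
  nV := 3
  kind := kind220
  adm i := by fin_cases i <;> simp [kind220, VertexKind.Admissible, hn]
  other x := match x with
    | ⟨0, .inl j⟩ => if j.val = 0 then some ⟨1, .inl ⟨0, by decide⟩⟩ else some ⟨2, .inl ⟨0, by decide⟩⟩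
    | ⟨1, .inl j⟩ => if j.val = 0 then some ⟨0, .inl ⟨0, by decide⟩⟩ else none
    | ⟨2, .inl j⟩ => if j.val = 0 then some ⟨0, .inl ⟨1, by decide⟩⟩ else none
    | ⟨0, .inr j⟩ => j.elim0
    | ⟨1, .inr _⟩ => some ⟨2, .inr ⟨0, by decide⟩⟩
    | ⟨2, .inr _⟩ => some ⟨1, .inr ⟨0, by decide⟩⟩
  other_ne := by decide
  other_symm := by decide
  other_isLeft := by decide
  exists_line := by decide

/-- **(2.21a)** p. 430: (1.8)_{1,0} whose φ′-legs close into a tadpole (through its differentiation), joined by the A′-line to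
(1.10)_{1,1}, whose two φ′-legs and Ã-leg are external. [cite: Balaban1983Higgs3, (2.21) p.430] -/
def g221a (nbar : ℕ) (hn : 1 ≤ nbar) : Graph nbar where
  nV := 2
  kind := kind221a
  adm i := by fin_cases i <;> simp [kind221a, VertexKind.Admissible, hn]
  other x := match x with
    | ⟨0, .inl j⟩ => some ⟨0, .inl ⟨1 - j.val, lt_of_le_of_lt (Nat.sub_le 1 j.val) (by decide)⟩⟩
    | ⟨1, .inl _⟩ => none
    | ⟨0, .inr _⟩ => some ⟨1, .inr ⟨0, by decide⟩⟩
    | ⟨1, .inr _⟩ => some ⟨0, .inr ⟨0, by decide⟩⟩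
  other_ne := by decide
  other_symm := by decide
  other_isLeft := by decide
  exists_line := by decide

/-- **(2.21b)** p. 430: (1.8)_{0,1} joined by a φ′-line carrying its differentiation to the undifferentiated leg of a vertex
(1.8)_{1,0}, which is joined to a third vertex (1.8)_{1,0} by the A′-line and by the φ′-line through both their differentiated
legs; external: the second φ′-legs of the first and third vertex. [cite: Balaban1983Higgs3, (2.21) p.430] -/
def g221b (nbar : ℕ) (hn : 1 ≤ nbar) : Graph nbar where
  nV := 3
  kind := kind220
  adm i := by fin_cases i <;> simp [kind220, VertexKind.Admissible, hn]
  other x := match x with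
    | ⟨0, .inl j⟩ => if j.val = 0 then some ⟨1, .inl ⟨1, by decide⟩⟩ else none
    | ⟨1, .inl j⟩ => if j.val = 0 then some ⟨2, .inl ⟨0, by decide⟩⟩ else some ⟨0, .inl ⟨0, by decide⟩⟩
    | ⟨2, .inl j⟩ => if j.val = 0 then some ⟨1, .inl ⟨0, by decide⟩⟩ else none
    | ⟨0, .inr j⟩ => j.elim0
    | ⟨1, .inr _⟩ => some ⟨2, .inr ⟨0, by decide⟩⟩
    | ⟨2, .inr _⟩ => some ⟨1, .inr ⟨0, by decide⟩⟩
  other_ne := by decide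
  other_symm := by decide
  other_isLeft := by decide
  exists_line := by decide

/-- **(2.21c)** p. 430: as (2.21b) with the other placement of the differentiations — the first φ′-line carries the
differentiations of the first AND the second vertex, the φ′-line between the second and third vertex only that of the third.
[cite: Balaban1983Higgs3, (2.21) p.430] -/
def g221c (nbar : ℕ) (hn : 1 ≤ nbar) : Graph nbar where
  nV := 3
  kind := kind220
  adm i := by fin_cases i <;> simp [kind220, VertexKind.Admissible, hn]
  other x := match x with
    | ⟨0, .inl j⟩ => if j.val = 0 then some ⟨1, .inl ⟨0, by decide⟩⟩ else none
    | ⟨1, .inl j⟩ => if j.val = 0 then some ⟨0, .inl ⟨0, by decide⟩⟩ else some ⟨2, .inl ⟨0, by decide⟩⟩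
    | ⟨2, .inl j⟩ => if j.val = 0 then some ⟨1, .inl ⟨1, by decide⟩⟩ else none
    | ⟨0, .inr j⟩ => j.elim0
    | ⟨1, .inr _⟩ => some ⟨2, .inr ⟨0, by decide⟩⟩
    | ⟨2, .inr _⟩ => some ⟨1, .inr ⟨0, by decide⟩⟩
  other_ne := by decide
  other_symm := by decide
  other_isLeft := by decide
  exists_line := by decide

/-- **(2.21d)** p. 430: (1.8)_{0,1} joined by the φ′-line through its differentiated leg to (1.10)_{2,0} carrying an A′-tadpole; the
second φ′-leg of each vertex external. [cite: Balaban1983Higgs3, (2.21) p.430] -/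
def g221d (nbar : ℕ) (hn : 2 ≤ nbar) : Graph nbar where
  nV := 2
  kind := kind221d
  adm i := by fin_cases i <;> simp [kind221d, VertexKind.Admissible] <;> omega
  other x := match x with
    | ⟨0, .inl j⟩ => if j.val = 0 then some ⟨1, .inl ⟨0, by decide⟩⟩ else none
    | ⟨1, .inl j⟩ => if j.val = 0 then some ⟨0, .inl ⟨0, by decide⟩⟩ else none
    | ⟨0, .inr j⟩ => j.elim0
    | ⟨1, .inr j⟩ => some ⟨1, .inr ⟨1 - j.val, lt_of_le_of_lt (Nat.sub_le 1 j.val) (by decide)⟩⟩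
  other_ne := by decide
  other_symm := by decide
  other_isLeft := by decide
  exists_line := by decide

/-- **(2.21e)** p. 430: (1.8)_{0,1} joined by the φ′-line through both differentiated legs to (1.8)_{2,0} carrying an A′-tadpole;
the second φ′-leg of each vertex external. [cite: Balaban1983Higgs3, (2.21) p.430] -/
def g221e (nbar : ℕ) (hn : 2 ≤ nbar) : Graph nbar where
  nV := 2
  kind := kind221e
  adm i := by fin_cases i <;> simp [kind221e, VertexKind.Admissible] <;> omega
  other x := match x with
    | ⟨0, .inl j⟩ => if j.val = 0 then some ⟨1, .inl ⟨0, by decide⟩⟩ else none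
    | ⟨1, .inl j⟩ => if j.val = 0 then some ⟨0, .inl ⟨0, by decide⟩⟩ else none
    | ⟨0, .inr j⟩ => j.elim0
    | ⟨1, .inr j⟩ => some ⟨1, .inr ⟨1 - j.val, lt_of_le_of_lt (Nat.sub_le 1 j.val) (by decide)⟩⟩
  other_ne := by decide
  other_symm := by decide
  other_isLeft := by decide
  exists_line := by decide

/-- **(2.21f)** p. 430: (1.8)_{0,1} joined by the φ′-line through its differentiated leg to the vertex (1.6), two of whose other
φ′-legs close into a tadpole; external: the second φ′-leg of (1.8)_{0,1} and the fourth leg of (1.6).  ((2.21g): in the attached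
form of the model the mass counterterm pictures are (2.21d)/(2.21f) themselves.) [cite: Balaban1983Higgs3, (2.21) p.430] -/
def g221f (nbar : ℕ) (hn : 1 ≤ nbar) : Graph nbar where
  nV := 2
  kind := kind221f
  adm i := by fin_cases i <;> simp [kind221f, VertexKind.Admissible, hn]
  other x := match x with
    | ⟨0, .inl j⟩ => if j.val = 0 then some ⟨1, .inl ⟨0, by decide⟩⟩ else none
    | ⟨1, .inl j⟩ =>
      if j.val = 0 then some ⟨0, .inl ⟨0, by decide⟩⟩
      else if j.val = 1 then some ⟨1, .inl ⟨2, by decide⟩⟩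
      else if j.val = 2 then some ⟨1, .inl ⟨1, by decide⟩⟩ else none
    | ⟨0, .inr j⟩ => j.elim0
    | ⟨1, .inr j⟩ => j.elim0
  other_ne := by decide
  other_symm := by decide
  other_isLeft := by decide
  exists_line := by decide

/-! ## The two further graphs of the class on the model (HOME/GAPS.md G-B3-03) -/

/-- **X1** (G-B3-03; not among (2.21)): (1.8)_{0,1} doubly φ′-linked to the vertex (1.6) (both its φ′-legs, the differentiated one
included, end on the φ⁴ vertex); external: the other two φ′-legs of (1.6) and the Ã-leg. [cite: Balaban1983Higgs3, (2.21) p.430] -/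
def gX1 (nbar : ℕ) (hn : 1 ≤ nbar) : Graph nbar where
  nV := 2
  kind := kind221f
  adm i := by fin_cases i <;> simp [kind221f, VertexKind.Admissible, hn]
  other x := match x with
    | ⟨0, .inl j⟩ => some ⟨1, .inl ⟨j.val, lt_trans j.isLt (by decide)⟩⟩
    | ⟨1, .inl j⟩ => if h : j.val < 2 then some ⟨0, .inl ⟨j.val, h⟩⟩ else none
    | ⟨0, .inr j⟩ => j.elim0
    | ⟨1, .inr j⟩ => j.elim0
  other_ne := by decide
  other_symm := by decide
  other_isLeft := by decide
  exists_line := by decide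

/-- **X2** (G-B3-03; not among (2.21)): (1.8)_{0,1} joined by the φ′-line through both differentiated legs to (1.8)_{1,0}, which is
joined by the A′-line to a third vertex (1.8)_{1,0} whose two φ′-legs form a tadpole; external: the second φ′-legs of the first
two vertices and the Ã-leg. [cite: Balaban1983Higgs3, (2.21) p.430] -/
def gX2 (nbar : ℕ) (hn : 1 ≤ nbar) : Graph nbar where
  nV := 3
  kind := kind220
  adm i := by fin_cases i <;> simp [kind220, VertexKind.Admissible, hn]
  other x := match x with
    | ⟨0, .inl j⟩ => if j.val = 0 then some ⟨1, .inl ⟨0, by decide⟩⟩ else none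
    | ⟨1, .inl j⟩ => if j.val = 0 then some ⟨0, .inl ⟨0, by decide⟩⟩ else none
    | ⟨2, .inl j⟩ => some ⟨2, .inl ⟨1 - j.val, lt_of_le_of_lt (Nat.sub_le 1 j.val) (by decide)⟩⟩
    | ⟨0, .inr j⟩ => j.elim0
    | ⟨1, .inr _⟩ => some ⟨2, .inr ⟨0, by decide⟩⟩
    | ⟨2, .inr _⟩ => some ⟨1, .inr ⟨0, by decide⟩⟩
  other_ne := by decide
  other_symm := by decide
  other_isLeft := by decide
  exists_line := by decide

variable {nbar : ℕ}

/-- kernel: all eleven graphs have two external φ′-legs, no external A′-leg, one Ã-leg, and no differentiation on an external leg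
(the class «two external scalar legs and one external vector leg»). [cite: Balaban1983Higgs3, (2.21) p.430] -/
theorem threeLeg_legs (hn : 1 ≤ nbar) (hn2 : 2 ≤ nbar) :
    (∀ G ∈ [g218 nbar hn, g219 nbar hn, g220 nbar hn, g221a nbar hn, g221b nbar hn, g221c nbar hn, g221f nbar hn,
        gX1 nbar hn, gX2 nbar hn, g221d nbar hn2, g221e nbar hn2],
      numExtScalarLegs G = 2 ∧ numExtVectorLegs G = 0 ∧ numTildeLegs G = 1 ∧ numExtDiffs G = 0) := by
  intro G hG
  simp only [List.mem_cons, List.mem_nil_iff, or_false] at hG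
  rcases hG with rfl | rfl | rfl | rfl | rfl | rfl | rfl | rfl | rfl | rfl | rfl <;>
    exact ⟨by rfl, by rfl, by rfl, by rfl⟩


/-! ## Degrees (d = 3): every one of them has D = 0 -/

/-- kernel: a graph of the model without vertices (1.13)–(1.15) whose d = 3 budget is 6 has D = 0
(`B3Sect3DegreeCensus.two_deg_three_eq_budget`). [cite: Balaban1983Higgs3, (2.2) p.423] -/
theorem deg_three_eq_zero_of_budget (G : Graph nbar) (hG : ¬ G.HasVertex1315) (hb : budget G = 6) : G.deg 3 = 0 := by
  have h := two_deg_three_eq_budget G hG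
  rw [hb] at h
  push_cast at h
  linarith

/-- p. 429 *"graphs with nonpositive degree"* / p. 443 *"the degree is 0"*: kernel, d = 3 — each of the nine pictures (2.18)–(2.21f)
and the two further graphs X1, X2 has D = 0 (budget: one A′-line or one vertex (1.6), two external φ′-legs, one Ã-leg).
[cite: Balaban1983Higgs3, (2.21) p.430] -/
theorem threeLeg_deg (hn : 1 ≤ nbar) (hn2 : 2 ≤ nbar) :
    (∀ G ∈ [g218 nbar hn, g219 nbar hn, g220 nbar hn, g221a nbar hn, g221b nbar hn, g221c nbar hn, g221f nbar hn,
        gX1 nbar hn, gX2 nbar hn, g221d nbar hn2, g221e nbar hn2], G.deg 3 = 0) := by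
  intro G hG
  simp only [List.mem_cons, List.mem_nil_iff, or_false] at hG
  rcases hG with rfl | rfl | rfl | rfl | rfl | rfl | rfl | rfl | rfl | rfl | rfl
  · exact deg_three_eq_zero_of_budget _ (by rintro ⟨i, hi⟩; fin_cases i <;> simp [g218, kind218, VertexKind.isOfForm1315] at hi) (by rfl)
  · exact deg_three_eq_zero_of_budget _ (by rintro ⟨i, hi⟩; fin_cases i <;> simp [g219, kind219, VertexKind.isOfForm1315] at hi) (by rfl)
  · exact deg_three_eq_zero_of_budget _ (by rintro ⟨i, hi⟩; fin_cases i <;> simp [g220, kind220, VertexKind.isOfForm1315] at hi) (by rfl)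
  · exact deg_three_eq_zero_of_budget _ (by rintro ⟨i, hi⟩; fin_cases i <;> simp [g221a, kind221a, VertexKind.isOfForm1315] at hi) (by rfl)
  · exact deg_three_eq_zero_of_budget _ (by rintro ⟨i, hi⟩; fin_cases i <;> simp [g221b, kind220, VertexKind.isOfForm1315] at hi) (by rfl)
  · exact deg_three_eq_zero_of_budget _ (by rintro ⟨i, hi⟩; fin_cases i <;> simp [g221c, kind220, VertexKind.isOfForm1315] at hi) (by rfl)
  · exact deg_three_eq_zero_of_budget _ (by rintro ⟨i, hi⟩; fin_cases i <;> simp [g221f, kind221f, VertexKind.isOfForm1315] at hi) (by rfl)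
  · exact deg_three_eq_zero_of_budget _ (by rintro ⟨i, hi⟩; fin_cases i <;> simp [gX1, kind221f, VertexKind.isOfForm1315] at hi) (by rfl)
  · exact deg_three_eq_zero_of_budget _ (by rintro ⟨i, hi⟩; fin_cases i <;> simp [gX2, kind220, VertexKind.isOfForm1315] at hi) (by rfl)
  · exact deg_three_eq_zero_of_budget _ (by rintro ⟨i, hi⟩; fin_cases i <;> simp [g221d, kind221d, VertexKind.isOfForm1315] at hi) (by rfl)
  · exact deg_three_eq_zero_of_budget _ (by rintro ⟨i, hi⟩; fin_cases i <;> simp [g221e, kind221e, VertexKind.isOfForm1315] at hi) (by rfl)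

end Literature.MathematicalPhysics.QuantumFieldTheory.Balaban1983to89.B3Sect2ThreeLegGraphs
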